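import Mathlib
import HarnessLib
import Summits.HubbardSuperconductivity.HubbardSuperconductivity.Theorems.KLProgrammeKLRegimeEngineScaleZeroE4Package
import Summits.HubbardSuperconductivity.HubbardSuperconductivity.Theorems.KLProgrammeKLRegimeEngineScaleZeroKernelNormsWt

/-!
# KL programme — scale-`0` engine: (E1-W)₀ PACKAGED (`KernelNormsWt … K 0` from the two weighted torus sums / under the stub binders)

Cell gate-hubbard-kl, seat p3 (g8).  Sequel of `…ScaleZeroKernelNormsWt`: `kernelNormsWt_zero_of_torusSums` is the torus-sum twin of
k3c2-p1's `firstMoment_zero_le_of_torusSums` (grid sizes derived exactly as there); `kernelNormsWt_zero_of_bounds` is the `KernelNormsWt`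
twin of p4 g9's `engineFirstMoments_zero_of_bounds` with the SAME hypothesis list (so the (E4)₀ door file discharges it too) and budget
conditions `N 2 ≥ 2t²(e⁵k̄K + 4e⁹κ₀²|U|)`, `N (2p) ≥ 2^p·4e⁹κ₀⁴κ₀^{-2p}t^{2p}(16e⁹κ₀²Ā|U|)^{p-2}|U|` (`p ≥ 2`), `N odd ≥ 0`,
`t = 2klIsoT + C_T + X`, `κ₀ = √(2(7+6047))`.  Degree 2 carries the counterterm's weighted moment `k̄K` (O(c) at deep frames, cell bus
11:55Z); degrees `≥ 4` are `U^{p-1}`-shaped.  Everything is proved; no definitions, no named facts, no sorry.  `--supports …-20437`.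
-/

noncomputable section

namespace Summit.HubbardSuperconductivity.HubbardSuperconductivity.Theorems.EngineV8

set_option linter.dupNamespace false -- summit = problem name (single-conjunct summit), D-0017

open Real Finset Complex Literature.MathematicalPhysics.QuantumLattice Literature.Probability.LatticeModels Literature.Probability.LatticeModels.BattleFederbush Literature.MathematicalPhysics.QuantumLattice.GrassmannAlgebra
open Summit.HubbardSuperconductivity.HubbardSuperconductivity.Theorems.KLRegimeSplit Summit.HubbardSuperconductivity.HubbardSuperconductivity.Theorems.DispersionFlow
open Summit.HubbardSuperconductivity.HubbardSuperconductivity.Theorems.KLProgrammeLegKernels Summit.HubbardSuperconductivity.HubbardSuperconductivity.Theorems.ScaleZeroDecay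
open scoped ComplexConjugate

section Torus

variable {L M : ℕ} [NeZero L]

/-- **(E1-W)₀ — `KernelNormsWt … K 0` from the TWO weighted product-torus sums `A_w`, `T_w`** (Gram constant `κ`, `θ_w < 1`),
for every budget `N` dominating the bi-graded bound (degrees `2p ≥ 4`), the full-step bound (degree `2`) and `0` (odd degrees). -/
theorem kernelNormsWt_zero_of_torusSums [NeZero M] {β : ℝ} (hβ : 0 < β) (U μ : ℝ) (K : TrigPolyC4v)
    {κ : ℝ} (hκ : 0 < κ)
    (hGB : IsGramBoundedR ((hubbardGridSub L M β (2 * (2 * M))).transpose * hubbardCovAboveCT L M β μ 0 K klE0 *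
      hubbardGridSub L M β (2 * (2 * M))) κ)
    {Aw : ℝ} (hAw : 0 < Aw)
    (hA : ∀ σ : Fin 2, ∑ a : TorusSite 1 (2 * (2 * M)), ∑ bv : TorusSite 2 L,
      (1 + (β / (2 * (2 * M) : ℕ) * cyclicDist (2 * (2 * M)) (a 0) 0 + torusSiteDist bv 0)) *
        ‖∑ q₀ : TorusSite 1 (2 * (2 * M)), ∑ qv : TorusSite 2 L, torusChar q₀ a * torusChar qv bv *
          gridSymbol L M (2 * (2 * M)) β (uvSymbolCT L M β μ K klE0) σ q₀ qv‖ ≤ Aw)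
    {ρ : ℝ} (hρ : 0 < ρ)
    (hθ : Real.exp 1 * Aw * normV (GridLeg (GridPoint L (2 * (2 * M)))) κ ρ
      (fun m' : ℕ => if m' = 1 then |β| / (2 * (2 * M) : ℕ) * ∑ z : TorusSite 2 L, ‖framePosKernel L K z‖ * (1 + torusSiteDist z 0) else if m' = 2 then |U| * |β| / (2 * (2 * M) : ℕ) else 0) / κ ^ 2 < 1)
    {Tw : ℝ} (hTw0 : 0 ≤ Tw)
    (hT : ∀ (ω : Fin (sectorCount 0)) (c : Fin 2), 1 / (|β| * (L : ℝ) ^ 2) *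
        ∑ dw : TorusSite 1 (2 * (2 * M)) × TorusSite 2 L,
          (1 + (β / (2 * (2 * M) : ℕ) * cyclicDist (2 * (2 * M)) (dw.1 0) 0 + torusSiteDist dw.2 0)) *
            ‖∑ k : FreqMomentum L M, klAnisoFamily L M β μ K klE0 0 ω k *
              (if c = 0 then torusChar (fun _ : Fin 1 => ((k.1 : ℕ) : ZMod (2 * (2 * M)))) dw.1 * torusChar k.2 dw.2 else conj (torusChar (fun _ : Fin 1 => ((k.1 : ℕ) : ZMod (2 * (2 * M)))) dw.1 * torusChar k.2 dw.2))‖ ≤ Tw)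
    (N : ℕ → ℝ) (hNodd : ∀ m, Odd m → 0 ≤ N m)
    (hN2 : imagTimeWeight β M ^ (2 - 1) *
        (Tw * ((sectorCount 0 : ℕ) * Tw) ^ (2 - 1) *
          (ρ⁻¹ ^ 2 * (Real.exp 1 * normV (GridLeg (GridPoint L (2 * (2 * M)))) κ ρ
              (fun m' : ℕ => if m' = 1 then |β| / (2 * (2 * M) : ℕ) * ∑ z : TorusSite 2 L, ‖framePosKernel L K z‖ * (1 + torusSiteDist z 0) else if m' = 2 then |U| * |β| / (2 * (2 * M) : ℕ) else 0)) /
            (1 - Real.exp 1 * Aw * normV (GridLeg (GridPoint L (2 * (2 * M)))) κ ρ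
              (fun m' : ℕ => if m' = 1 then |β| / (2 * (2 * M) : ℕ) * ∑ z : TorusSite 2 L, ‖framePosKernel L K z‖ * (1 + torusSiteDist z 0) else if m' = 2 then |U| * |β| / (2 * (2 * M) : ℕ) else 0) / κ ^ 2))) ≤ N 2)
    (hNp : ∀ p, 2 ≤ p → imagTimeWeight β M ^ (2 * p - 1) *
        (Tw * ((sectorCount 0 : ℕ) * Tw) ^ (2 * p - 1) *
          (ρ⁻¹ ^ (2 * p) * (Real.exp 1 * ((Real.exp 2 * (κ + ρ)) ^ (2 * 2) * (|U| * |β| / (2 * (2 * M) : ℕ)))) *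
            (Real.exp 1 * Aw * ((Real.exp 2 * (κ + ρ)) ^ (2 * 2) * (|U| * |β| / (2 * (2 * M) : ℕ))) / κ ^ 2) ^ (p - 2) /
              (1 - Real.exp 1 * Aw * normV (GridLeg (GridPoint L (2 * (2 * M)))) κ ρ
                (fun m' : ℕ => if m' = 1 then |β| / (2 * (2 * M) : ℕ) * ∑ z : TorusSite 2 L, ‖framePosKernel L K z‖ * (1 + torusSiteDist z 0) else if m' = 2 then |U| * |β| / (2 * (2 * M) : ℕ) else 0) / κ ^ 2) ^ p)) ≤ N (2 * p)) :
    KernelNormsWt L M N β U μ K 0 := by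
  haveI : NeZero (2 * (2 * M)) := ⟨by have := NeZero.ne M; omega⟩
  have hMN : 2 * M ≤ 2 * (2 * M) := by omega
  set φ : TorusSite 1 (2 * (2 * M)) → TorusSite 2 L → ℝ := fun a bv =>
    1 + (β / (2 * (2 * M) : ℕ) * cyclicDist (2 * (2 * M)) (a 0) 0 + torusSiteDist bv 0) with hφ
  have hφeven : ∀ a bv, φ (-a) (-bv) = φ a bv := fun a bv => scaleZeroMomentWeight_neg β a bv
  have hφ0 : ∀ a bv, 0 ≤ φ a bv := fun a bv => scaleZeroMomentWeight_nonneg hβ.le a bv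
  have hrow : ∀ X, ∑ Y, ‖((hubbardGridSub L M β (2 * (2 * M))).transpose * hubbardCovAboveCT L M β μ 0 K klE0 *
      hubbardGridSub L M β (2 * (2 * M))) X Y‖ * gridLabelWt L (2 * (2 * M)) β {gridLegPos X, gridLegPos Y} ≤ Aw := by
    intro X
    rw [hubbardCovAboveCT_zero_seed_eq_normalCovariance_uvSymbolCT]
    refine le_of_eq_of_le (sum_congr rfl fun Y _ => by rw [gridLabelWt_pair_gridLegPos hβ.le]) ?_
    exact sum_norm_mul_gridSub_pullback_row_le_of_weight hβ.ne' hMN _ φ hφeven hA X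
  have hcol : ∀ Y, ∑ X, ‖((hubbardGridSub L M β (2 * (2 * M))).transpose * hubbardCovAboveCT L M β μ 0 K klE0 *
      hubbardGridSub L M β (2 * (2 * M))) X Y‖ * gridLabelWt L (2 * (2 * M)) β {gridLegPos X, gridLegPos Y} ≤ Aw := by
    intro Y
    rw [hubbardCovAboveCT_zero_seed_eq_normalCovariance_uvSymbolCT]
    refine le_of_eq_of_le (sum_congr rfl fun X _ => by rw [gridLabelWt_pair_gridLegPos hβ.le]) ?_
    exact sum_norm_mul_gridSub_pullback_col_le_of_weight hβ.ne' hMN _ φ hφeven hA Y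
  have hrow' : ∀ X'' : SpaceTimeIdx L M × SectorLeg (sectorCount 0), ∑ X' : GridLeg (GridPoint L (2 * (2 * M))),
      ‖(sectorAnalysisMatrix L M β (klAnisoFamily L M β μ K klE0 0) * hubbardGridSub L M β (2 * (2 * M))) X'' X'‖ *
        gridLabelWt L (2 * (2 * M)) β {latticeLegPos (2 * (2 * M)) X'', gridLegPos X'} ≤ Tw := by
    rintro ⟨y, ⟨⟨ω, σ⟩, c⟩⟩
    have hzero : ∀ X' : GridLeg (GridPoint L (2 * (2 * M))), (X'.1.2 ≠ σ ∨ X'.2 ≠ c) →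
        (sectorAnalysisMatrix L M β (klAnisoFamily L M β μ K klE0 0) * hubbardGridSub L M β (2 * (2 * M))) (y, ((ω, σ), c)) X' = 0 := by
      intro X' h
      rw [sectorAnalysis_mul_hubbardGridSub_apply, if_neg]
      rintro ⟨h2, h3⟩
      rcases h with h | h
      · exact h h2
      · exact h h3
    calc ∑ X' : GridLeg (GridPoint L (2 * (2 * M))),
          ‖(sectorAnalysisMatrix L M β (klAnisoFamily L M β μ K klE0 0) * hubbardGridSub L M β (2 * (2 * M))) (y, ((ω, σ), c)) X'‖ *
            gridLabelWt L (2 * (2 * M)) β {latticeLegPos (2 * (2 * M)) (y, ((ω, σ), c)), gridLegPos X'}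
        = ∑ q : GridPoint L (2 * (2 * M)),
          ‖(sectorAnalysisMatrix L M β (klAnisoFamily L M β μ K klE0 0) * hubbardGridSub L M β (2 * (2 * M))) (y, ((ω, σ), c)) ((q, σ), c)‖ *
            φ (fun _ : Fin 1 => ((q.1 : ℕ) : ZMod (2 * (2 * M))) - 2 * ((y.1 : ℕ) : ZMod (2 * (2 * M)))) (q.2 - y.2) := by
          rw [Fintype.sum_prod_type, Fintype.sum_prod_type]
          refine sum_congr rfl fun q _ => ?_
          rw [Fintype.sum_eq_single σ fun σ' hσ' => ?_, Fintype.sum_eq_single c fun c' hc' => ?_]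
          · rw [gridLabelWt_pair_latticeLegPos_gridLegPos hβ.le]
          · rw [hzero ((q, σ), c') (Or.inr hc'), norm_zero, zero_mul]
          · exact sum_eq_zero fun c' _ => by rw [hzero ((q, σ'), c') (Or.inl hσ'), norm_zero, zero_mul]
      _ ≤ Tw := rowSum_mul_sectorAnalysis_mul_hubbardGridSub_le_of_weight hβ.ne' _ φ hT ω σ c y
  have hcol' : ∀ X' : GridLeg (GridPoint L (2 * (2 * M))), ∑ X'' : SpaceTimeIdx L M × SectorLeg (sectorCount 0),
      ‖(sectorAnalysisMatrix L M β (klAnisoFamily L M β μ K klE0 0) * hubbardGridSub L M β (2 * (2 * M))) X'' X'‖ *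
        gridLabelWt L (2 * (2 * M)) β {latticeLegPos (2 * (2 * M)) X'', gridLegPos X'} ≤ (sectorCount 0 : ℕ) * Tw := by
    rintro ⟨⟨q, σ⟩, c⟩
    have hzero : ∀ X'' : SpaceTimeIdx L M × SectorLeg (sectorCount 0), (X''.2.1.2 ≠ σ ∨ X''.2.2 ≠ c) →
        (sectorAnalysisMatrix L M β (klAnisoFamily L M β μ K klE0 0) * hubbardGridSub L M β (2 * (2 * M))) X'' ((q, σ), c) = 0 := by
      intro X'' h
      rw [sectorAnalysis_mul_hubbardGridSub_apply, if_neg]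
      rintro ⟨h2, h3⟩
      rcases h with h | h
      · exact h h2.symm
      · exact h h3.symm
    calc ∑ X'' : SpaceTimeIdx L M × SectorLeg (sectorCount 0),
          ‖(sectorAnalysisMatrix L M β (klAnisoFamily L M β μ K klE0 0) * hubbardGridSub L M β (2 * (2 * M))) X'' ((q, σ), c)‖ *
            gridLabelWt L (2 * (2 * M)) β {latticeLegPos (2 * (2 * M)) X'', gridLegPos ((q, σ), c)}
        = ∑ ω : Fin (sectorCount 0), ∑ y : SpaceTimeIdx L M,
          ‖(sectorAnalysisMatrix L M β (klAnisoFamily L M β μ K klE0 0) * hubbardGridSub L M β (2 * (2 * M))) (y, ((ω, σ), c)) ((q, σ), c)‖ *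
            φ (fun _ : Fin 1 => ((q.1 : ℕ) : ZMod (2 * (2 * M))) - 2 * ((y.1 : ℕ) : ZMod (2 * (2 * M)))) (q.2 - y.2) := by
          rw [Fintype.sum_prod_type, sum_comm, Fintype.sum_prod_type, Fintype.sum_prod_type]
          refine sum_congr rfl fun ω _ => ?_
          rw [Fintype.sum_eq_single σ fun σ' hσ' => ?_]
          · rw [Fintype.sum_eq_single c fun c' hc' => ?_]
            · exact sum_congr rfl fun y _ => by rw [gridLabelWt_pair_latticeLegPos_gridLegPos hβ.le]
            · exact sum_eq_zero fun y _ => by rw [hzero (y, ((ω, σ), c')) (Or.inr hc'), norm_zero, zero_mul]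
          · exact sum_eq_zero fun c' _ => sum_eq_zero fun y _ => by rw [hzero (y, ((ω, σ'), c')) (Or.inl hσ'), norm_zero, zero_mul]
      _ ≤ (sectorCount 0 : ℕ) * Tw := colSum_mul_sectorAnalysis_mul_hubbardGridSub_le_of_weight hβ.ne' _ φ hφ0 hT σ c q
  exact kernelNormsWt_zero_of_wgridStep hβ U μ K hκ hGB hAw hrow hcol hρ hθ (by positivity) hrow' hcol' N hNodd hN2 hNp

end Torus

/-- **(E1-W)₀ under the binders of `stub_engine_scale0`** with p4's (E4)₀ packaging hypotheses verbatim (`B`, `Ā`, `k̄K`, the two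
smallness conditions, `hCT`, `hTX`), for every budget `N` with `N 2 ≥ 2t²(e⁵k̄K + 4e⁹κ₀²|U|)`,
`N (2p) ≥ 2^p·4e⁹κ₀⁴κ₀^{-2p}t^{2p}(16e⁹κ₀²Ā|U|)^{p-2}|U|` (`p ≥ 2`), `N odd ≥ 0` (`t = 2klIsoT + C_T + X`, `κ₀ = √(2(7+6047))`). -/
theorem kernelNormsWt_zero_of_bounds {C_T : ℝ} (hCT0 : 0 ≤ C_T)
    (hCT : ∀ (L M : ℕ) [NeZero L] [NeZero M] (R : RenConsts) (U : ℝ) (N : ℕ) (μ : ℝ) (K : TrigPolyC4v),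
      FrameOK R U N μ K → (∀ j, 0 ≤ R.Gfr j) → μ ∈ klWindowC → 16 / 15 * (R.Gfr 0 * |U|) ≤ 1 / 50 → (2 : ℝ) ^ 15 ≤ L →
      ∀ β : ℝ, klBetaMin ≤ β → β ≤ M → klE0 * β ≤ Real.pi * (2 * M - 13) →
      ∀ (ω : Fin (sectorCount 0)) (c : Fin 2),
        1 / (|β| * (L : ℝ) ^ 2) *
            ∑ dw : TorusSite 1 (2 * (2 * M)) × TorusSite 2 L,
              (β / (2 * (2 * M) : ℕ) * cyclicDist (2 * (2 * M)) (dw.1 0) 0) *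
                ‖∑ k : FreqMomentum L M, klAnisoFamily L M β μ K klE0 0 ω k *
                  (if c = 0 then torusChar (fun _ : Fin 1 => ((k.1 : ℕ) : ZMod (2 * (2 * M)))) dw.1 * torusChar k.2 dw.2 else conj (torusChar (fun _ : Fin 1 => ((k.1 : ℕ) : ZMod (2 * (2 * M)))) dw.1 * torusChar k.2 dw.2))‖ ≤
          C_T * (M / β))
    {X : ℝ} (hX0 : 0 ≤ X)
    (P : SplitConsts) (R : RenConsts) (c : ℝ) (hP : P.WF) (hR : R.WF2) (hc : 0 < c) (hc₃ : c ≤ klEngC₃3 P R)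
    (μ : ℝ) (hμ : μ ∈ klWindowC) (U : ℝ) (hU : 0 < U) (hU₀ : U ≤ klEngU₀3 P R c) (β : ℝ) (hβ : klBetaMin ≤ β)
    (hβc : β ≤ Real.exp (c / U ^ 2)) (K : TrigPolyC4v) (hK : FrameOK R U (nScales β) μ K) (L M : ℕ) [NeZero L] [NeZero M]
    (hL : klEngL₃ β U ≤ L) (hM : klEngM₃ β U L ≤ M)
    {B : ℝ} (hB1 : 1 ≤ B) (hB : ∀ i ≤ 5, ∀ t, ‖iteratedDeriv i salmhoferCutoff t‖ ≤ B)
    {Abar : ℝ}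
    (hAbar : klScaleZeroA0 + uvTimeMomentConst klE0 7 32 +
        2 * (uvSpaceMomentConst klE0 1 (uvPieceSq klE0 (uvBaseQ B klE0 4) (uvBaseQ' B klE0 4)) +
          (1 / 4 * Real.sqrt (216 * (1 / klE0 + 1 / 2)) *
              ∑ e : Fin 2 × Fin 2, (uvLinV klE0 (1 + (e.1 : ℕ) + (e.2 : ℕ)) *
                  (B * ((1 + ((e.1 : ℕ) + (e.2 : ℕ)) + 2).factorial : ℝ) * (4 / klE0) ^ (1 + ((e.1 : ℕ) + (e.2 : ℕ)) + 1)) +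
                uvLinD klE0 (1 + (e.1 : ℕ) + (e.2 : ℕ)) *
                  (B * ((1 + ((e.1 : ℕ) + (e.2 : ℕ)) + 3).factorial : ℝ) * (4 / klE0) ^ (1 + ((e.1 : ℕ) + (e.2 : ℕ)) + 2)))) *
            (4608 * (1 + R.Gfr 0 + R.Gfr 1 + R.Gfr 2 + R.Gfr 3) ^ 4 * ((((nScales β : ℕ) : ℝ) + 1) * U ^ 2 + 2 * |U|))) ≤ Abar)
    {kKbar : ℝ}
    (hkKbar : klKappaFrameC R * |U| + 2 * ((((nScales β : ℕ) : ℝ) + 1) * U ^ 2 *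
        (6 * (Real.pi * R.Gfr 1 / 2 + Real.pi ^ 2 * R.Gfr 2 / (2 * Real.sqrt 2) + Real.pi ^ 3 * R.Gfr 3 / 8))) ≤ kKbar)
    (hθ1 : 16 * Real.exp 1 ^ 5 * Abar * kKbar ≤ 1) (hθ2 : 64 * Real.exp 1 ^ 9 * Real.sqrt (2 * (7 + 6047)) ^ 2 * Abar * |U| ≤ 1)
    (hTX : ∀ (ω : Fin (sectorCount 0)) (c' : Fin 2), 1 / (|β| * (L : ℝ) ^ 2) *
        ∑ dw : TorusSite 1 (2 * (2 * M)) × TorusSite 2 L, (torusSiteDist dw.2 0 : ℝ) *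
            ‖∑ k : FreqMomentum L M, klAnisoFamily L M β μ K klE0 0 ω k *
              (if c' = 0 then torusChar (fun _ : Fin 1 => ((k.1 : ℕ) : ZMod (2 * (2 * M)))) dw.1 * torusChar k.2 dw.2 else conj (torusChar (fun _ : Fin 1 => ((k.1 : ℕ) : ZMod (2 * (2 * M)))) dw.1 * torusChar k.2 dw.2))‖ ≤ X * (M / β))
    (N : ℕ → ℝ) (hNodd : ∀ m, Odd m → 0 ≤ N m)
    (hN2 : 2 * (2 * klIsoT + C_T + X) ^ 2 *
        (Real.exp 1 ^ 5 * kKbar + 4 * Real.exp 1 ^ 9 * Real.sqrt (2 * (7 + 6047)) ^ 2 * |U|) ≤ N 2)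
    (hNp : ∀ p, 2 ≤ p → 2 ^ p * (4 * Real.exp 1 ^ 9 * Real.sqrt (2 * (7 + 6047)) ^ 4 * (Real.sqrt (2 * (7 + 6047)))⁻¹ ^ (2 * p) *
        (2 * klIsoT + C_T + X) ^ (2 * p) * (16 * Real.exp 1 ^ 9 * Real.sqrt (2 * (7 + 6047)) ^ 2 * Abar * |U|) ^ (p - 2) * |U|) ≤
          N (2 * p)) :
    KernelNormsWt L M N β U μ K 0 := by

  classical
  haveI : NeZero (2 * (2 * M)) := ⟨by have := NeZero.ne M; omega⟩
  have hRwf : R.WF := hR.wf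
  have hGfr : ∀ j, 0 ≤ R.Gfr j := hRwf.2.2
  have hβ0 : 0 < β := beta_pos_of_klBetaMin_le hβ
  have hβ128 : (128 : ℝ) ≤ β := by simpa [klBetaMin] using hβ
  obtain ⟨hL15, hβL, hM2, hβM, hβ3M, hMβ3⟩ := scaleZero_regime_sizes hβ hL hM
  have hMpos : (0 : ℝ) < M := by linarith only [hβ128, hβM]
  have hLpos : (0 : ℝ) < L := by linarith only [hβ128, hβL]
  have hU1 : |U| ≤ 1 := abs_le_one_of_le_klEngU₀3 hU hU₀
  have hUabs : |U| = U := abs_of_pos hU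
  have hκU : 16 / 15 * (R.Gfr 0 * |U|) ≤ 1 / 50 := gfr0_abs_mul_le_of_le_klEngU₀3 hU hU₀
  have hMβ13 : klE0 * β ≤ Real.pi * (2 * M - 13) := by
    have hE : klE0 = 1 / 32 := by norm_num [klE0]
    rw [hE]
    have hβ3 : (128 : ℝ) ^ 2 * β ≤ β ^ 3 := by
      have h1 : 0 ≤ β * (β - 128) * (β + 128) := by
        have := sub_nonneg.2 hβ128
        positivity
      nlinarith only [h1]
    have h2 : β ≤ 2 * (M : ℝ) - 13 := by linarith only [hβ3, hβ3M, hβ128]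
    have h3 : (1 : ℝ) / 32 * β ≤ 3 * (2 * (M : ℝ) - 13) := by linarith only [h2, hβ128]
    have h4 : 3 * (2 * (M : ℝ) - 13) ≤ Real.pi * (2 * M - 13) :=
      mul_le_mul_of_nonneg_right Real.pi_gt_three.le (by linarith only [h2, hβ128])
    exact h3.trans h4
  have hN4 : (((2 * (2 * M) : ℕ) : ℝ)) = 4 * M := by push_cast; ring
  have hN0 : 0 < (((2 * (2 * M) : ℕ) : ℝ)) := by rw [hN4]; positivity
  have hMN : 2 * M ≤ 2 * (2 * M) := by omega
  have hκ0 : 0 < Real.sqrt (2 * (7 + 6047)) := Real.sqrt_pos.2 (by norm_num)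
  have hA0pos : 0 < klScaleZeroA0 := klScaleZeroA0_pos
  have hGB := isGramBoundedR_scaleZero_of_frameOK_sharp (L := L) (M := M) hK hβ hβL
  have hAXnn : 0 ≤ uvTimeMomentConst klE0 7 32 := by
    have := timeMoment_scaleZero_of_frameOK (L := L) hK hβ hβ3M hMN 0
    refine le_trans ?_ this
    exact mul_nonneg (div_nonneg hβ0.le (Nat.cast_nonneg _)) (Finset.sum_nonneg fun a _ => Finset.sum_nonneg fun bv _ =>
      mul_nonneg (mul_nonneg (div_nonneg hβ0.le (Nat.cast_nonneg _)) (abs_nonneg _)) (norm_nonneg _))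
  have hAbar0 : 0 < Abar := by
    refine lt_of_lt_of_le ?_ hAbar
    have hsp := spaceMoment_scaleZero_of_frameOK (L := L) (M := M) (N := 2 * (2 * M)) hK hRwf hU1 hβ hβ3M hMN hB1 hB
      (l := 0) (l' := 1) (by decide) 0
    have hsp0 : 0 ≤ β / (((2 * (2 * M) : ℕ) : ℝ)) * ∑ a : TorusSite 1 (2 * (2 * M)), ∑ bv : TorusSite 2 L,
        |(((bv 0).valMinAbs : ℤ) : ℝ)| * ‖∑ q₀ : TorusSite 1 (2 * (2 * M)), ∑ qv : TorusSite 2 L, torusChar q₀ a * torusChar qv bv *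
          gridSymbol L M (2 * (2 * M)) β (uvSymbolCT L M β μ K klE0) 0 q₀ qv‖ :=
      mul_nonneg (div_nonneg hβ0.le (Nat.cast_nonneg _)) (Finset.sum_nonneg fun a _ => Finset.sum_nonneg fun bv _ =>
        mul_nonneg (abs_nonneg _) (norm_nonneg _))
    have hAT := hAXnn
    linarith only [hsp0.trans hsp, hAT, hA0pos]
  have hAw : 0 < 4 * M * Abar / β := by positivity
  have hA : ∀ σ : Fin 2, ∑ a : TorusSite 1 (2 * (2 * M)), ∑ bv : TorusSite 2 L,
      (1 + (β / (2 * (2 * M) : ℕ) * cyclicDist (2 * (2 * M)) (a 0) 0 + torusSiteDist bv 0)) *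
        ‖∑ q₀ : TorusSite 1 (2 * (2 * M)), ∑ qv : TorusSite 2 L, torusChar q₀ a * torusChar qv bv *
          gridSymbol L M (2 * (2 * M)) β (uvSymbolCT L M β μ K klE0) σ q₀ qv‖ ≤ 4 * M * Abar / β := by
    intro σ
    have h := weightedSum_le_of_parts (L := L) (N := 2 * (2 * M)) hβ0
      (fun a bv => ‖∑ q₀ : TorusSite 1 (2 * (2 * M)), ∑ qv : TorusSite 2 L, torusChar q₀ a * torusChar qv bv *
          gridSymbol L M (2 * (2 * M)) β (uvSymbolCT L M β μ K klE0) σ q₀ qv‖) (fun _ _ => norm_nonneg _)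
      (plainTorusSum_scaleZero_le_A0 (L := L) hK hβ hβ3M σ) (timeMoment_scaleZero_of_frameOK (L := L) hK hβ hβ3M hMN σ)
      (fun l => by
        fin_cases l
        · exact spaceMoment_scaleZero_of_frameOK (L := L) (M := M) (N := 2 * (2 * M)) hK hRwf hU1 hβ hβ3M hMN hB1 hB
            (l := 0) (l' := 1) (by decide) σ
        · exact spaceMoment_scaleZero_of_frameOK (L := L) (M := M) (N := 2 * (2 * M)) hK hRwf hU1 hβ hβ3M hMN hB1 hB
            (l := 1) (l' := 0) (by decide) σ)
    refine h.trans ?_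
    rw [hN4]
    have : (4 : ℝ) * M / β * _ ≤ 4 * M / β * Abar := mul_le_mul_of_nonneg_left hAbar (by positivity)
    calc _ ≤ 4 * M / β * Abar := this
      _ = 4 * M * Abar / β := by ring
  have hkK : ∑ z : TorusSite 2 L, ‖framePosKernel L K z‖ * (1 + torusSiteDist z 0) ≤ kKbar :=
    (frameKernel_weightedL1_le (L := L) hRwf hU.ne' hU1 hK).trans hkKbar
  have hθ := thetaW_scaleZero_le_half (L := L) (M := M) hβ0 K hAbar0.le hkK hθ1 hθ2
  obtain ⟨T₀, hT₀0, hT₀⟩ := TorusFourierL2.exists_isoTorusBoundAt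
  have hIso := isoTorusBoundAt_klIsoT hT₀0 hT₀
  have hTw0 : 0 ≤ M / β * (2 * klIsoT + C_T + X) := by
    have := klIsoT_nonneg
    positivity
  have hT : ∀ (ω : Fin (sectorCount 0)) (c' : Fin 2), 1 / (|β| * (L : ℝ) ^ 2) *
      ∑ dw : TorusSite 1 (2 * (2 * M)) × TorusSite 2 L,
        (1 + (β / (2 * (2 * M) : ℕ) * cyclicDist (2 * (2 * M)) (dw.1 0) 0 + torusSiteDist dw.2 0)) *
          ‖∑ k : FreqMomentum L M, klAnisoFamily L M β μ K klE0 0 ω k *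
            (if c' = 0 then torusChar (fun _ : Fin 1 => ((k.1 : ℕ) : ZMod (2 * (2 * M)))) dw.1 * torusChar k.2 dw.2 else conj (torusChar (fun _ : Fin 1 => ((k.1 : ℕ) : ZMod (2 * (2 * M)))) dw.1 * torusChar k.2 dw.2))‖ ≤
      M / β * (2 * klIsoT + C_T + X) := by
    intro ω c'
    set g : TorusSite 1 (2 * (2 * M)) × TorusSite 2 L → ℝ := fun dw =>
      ‖∑ k : FreqMomentum L M, klAnisoFamily L M β μ K klE0 0 ω k *
        (if c' = 0 then torusChar (fun _ : Fin 1 => ((k.1 : ℕ) : ZMod (2 * (2 * M)))) dw.1 * torusChar k.2 dw.2 else conj (torusChar (fun _ : Fin 1 => ((k.1 : ℕ) : ZMod (2 * (2 * M)))) dw.1 * torusChar k.2 dw.2))‖ with hg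
    have hg0 : ∀ dw, 0 ≤ g dw := fun dw => norm_nonneg _
    have hpre : 0 ≤ 1 / (|β| * (L : ℝ) ^ 2) := by positivity
    have hplain : 1 / (|β| * (L : ℝ) ^ 2) * ∑ dw : TorusSite 1 (2 * (2 * M)) × TorusSite 2 L, g dw ≤ klIsoT * (2 * M / β) := by
      have h := hIso P R c hP hR hc hc₃ μ hμ U hU hU₀ β hβ hβc K hK L M hL hM 0 ω c'
      have hw : klIsoT / imagTimeWeight β M = klIsoT * (2 * M / β) := by
        rw [imagTimeWeight]; field_simp
      rw [hw] at h
      exact h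
    have htime : 1 / (|β| * (L : ℝ) ^ 2) * ∑ dw : TorusSite 1 (2 * (2 * M)) × TorusSite 2 L,
        (β / (2 * (2 * M) : ℕ) * cyclicDist (2 * (2 * M)) (dw.1 0) 0) * g dw ≤ C_T * (M / β) :=
      hCT L M R U (nScales β) μ K hK hGfr hμ hκU hL15 β hβ hβM hMβ13 ω c'
    have hspace : 1 / (|β| * (L : ℝ) ^ 2) * ∑ dw : TorusSite 1 (2 * (2 * M)) × TorusSite 2 L,
        (torusSiteDist dw.2 0 : ℝ) * g dw ≤ X * (M / β) := hTX ω c'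
    have hsplit : ∑ dw : TorusSite 1 (2 * (2 * M)) × TorusSite 2 L,
        (1 + (β / (2 * (2 * M) : ℕ) * cyclicDist (2 * (2 * M)) (dw.1 0) 0 + torusSiteDist dw.2 0)) * g dw =
        ∑ dw : TorusSite 1 (2 * (2 * M)) × TorusSite 2 L, g dw +
          ∑ dw : TorusSite 1 (2 * (2 * M)) × TorusSite 2 L, (β / (2 * (2 * M) : ℕ) * cyclicDist (2 * (2 * M)) (dw.1 0) 0) * g dw +
          ∑ dw : TorusSite 1 (2 * (2 * M)) × TorusSite 2 L, (torusSiteDist dw.2 0 : ℝ) * g dw := by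
      rw [← Finset.sum_add_distrib, ← Finset.sum_add_distrib]
      exact Finset.sum_congr rfl fun dw _ => by ring
    rw [hsplit, mul_add, mul_add]
    have : klIsoT * (2 * M / β) + C_T * (M / β) + X * (M / β) = M / β * (2 * klIsoT + C_T + X) := by ring
    linarith only [hplain, htime, hspace, this]

  have hsc : ((sectorCount 0 : ℕ) : ℝ) = 2 := by norm_num [sectorCount]
  set t := 2 * klIsoT + C_T + X with ht
  have ht0 : 0 ≤ t := by have := klIsoT_nonneg; positivity
  have hkKbar0 : 0 ≤ kKbar := by
    have h0 : 0 ≤ ∑ z : TorusSite 2 L, ‖framePosKernel L K z‖ * (1 + torusSiteDist z 0) :=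
      Finset.sum_nonneg fun z _ => mul_nonneg (norm_nonneg _)
        (by have : (0 : ℝ) ≤ torusSiteDist z 0 := Nat.cast_nonneg _; linarith)
    exact h0.trans hkK
  set κ₀ := Real.sqrt (2 * (7 + 6047)) with hκ₀def
  have hθv1 : 1 / 2 ≤ 1 - Real.exp 1 * (4 * M * Abar / β) *
        normV (GridLeg (GridPoint L (2 * (2 * M)))) κ₀ κ₀
          ((fun m' : ℕ => if m' = 1 then |β| / (2 * (2 * M) : ℕ) * ∑ z : TorusSite 2 L, ‖framePosKernel L K z‖ * (1 + torusSiteDist z 0) else if m' = 2 then |U| * |β| / (2 * (2 * M) : ℕ) else 0)) / κ₀ ^ 2 := by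
    linarith only [hθ]
  have hε : imagTimeWeight β M = β / (2 * M) := rfl
  have hε0 : 0 ≤ imagTimeWeight β M := imagTimeWeight_nonneg hβ0.le M
  have he2 : Real.exp 2 = Real.exp 1 ^ 2 := by rw [← Real.exp_nat_mul]; norm_num
  have hκne : κ₀ ≠ 0 := hκ0.ne'
  have hβne : β ≠ 0 := hβ0.ne'
  have hMne : (M : ℝ) ≠ 0 := hMpos.ne'
  have hnV : normV (GridLeg (GridPoint L (2 * (2 * M)))) κ₀ κ₀
          ((fun m' : ℕ => if m' = 1 then |β| / (2 * (2 * M) : ℕ) * ∑ z : TorusSite 2 L, ‖framePosKernel L K z‖ * (1 + torusSiteDist z 0) else if m' = 2 then |U| * |β| / (2 * (2 * M) : ℕ) else 0)) =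
      (Real.exp 2 * (κ₀ + κ₀)) ^ 2 *
          (|β| / (2 * (2 * M) : ℕ) * ∑ z : TorusSite 2 L, ‖framePosKernel L K z‖ * (1 + torusSiteDist z 0)) +
        (Real.exp 2 * (κ₀ + κ₀)) ^ 4 * (|U| * |β| / (2 * (2 * M) : ℕ)) :=
    normV_scaleZeroPinnedL1_eq (four_le_card_gridLeg (L := L) (Ng := 2 * (2 * M))) _ _ β U _ (2 * (2 * M))
  have hnVle : normV (GridLeg (GridPoint L (2 * (2 * M)))) κ₀ κ₀
          ((fun m' : ℕ => if m' = 1 then |β| / (2 * (2 * M) : ℕ) * ∑ z : TorusSite 2 L, ‖framePosKernel L K z‖ * (1 + torusSiteDist z 0) else if m' = 2 then |U| * |β| / (2 * (2 * M) : ℕ) else 0)) ≤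
      ((Real.exp 2 * (κ₀ + κ₀)) ^ 2 * (|β| / (2 * (2 * M) : ℕ) * kKbar) + (Real.exp 2 * (κ₀ + κ₀)) ^ 4 * (|U| * |β| / (2 * (2 * M) : ℕ))) := by
    rw [hnV]
    have h1 : |β| / (2 * (2 * M) : ℕ) * (∑ z : TorusSite 2 L, ‖framePosKernel L K z‖ * (1 + torusSiteDist z 0)) ≤
        |β| / (2 * (2 * M) : ℕ) * kKbar := mul_le_mul_of_nonneg_left hkK (by positivity)
    nlinarith only [h1, sq_nonneg (Real.exp 2 * (κ₀ + κ₀))]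
  refine kernelNormsWt_zero_of_torusSums (L := L) (M := M) hβ0 U μ K hκ0 hGB hAw hA hκ0 (lt_of_le_of_lt hθ (by norm_num))
    hTw0 hT N hNodd ?_ ?_
  · -- degree 2: `ε·T_w·(2T_w)·κ₀⁻²·e·normV/(1-θ_w) ≤ 2t²(e⁵k̄K + 4e⁹κ₀²|U|)`
    refine le_trans ?_ hN2
    rw [hsc, show (2 : ℕ) - 1 = 1 from rfl, pow_one, pow_one]
    have hnum0 : 0 ≤ κ₀⁻¹ ^ 2 * (Real.exp 1 * ((Real.exp 2 * (κ₀ + κ₀)) ^ 2 * (|β| / (2 * (2 * M) : ℕ) * kKbar) + (Real.exp 2 * (κ₀ + κ₀)) ^ 4 * (|U| * |β| / (2 * (2 * M) : ℕ)))) := by positivity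
    calc imagTimeWeight β M * (M / β * t * (2 * (M / β * t)) * (κ₀⁻¹ ^ 2 * (Real.exp 1 *
            normV (GridLeg (GridPoint L (2 * (2 * M)))) κ₀ κ₀
          ((fun m' : ℕ => if m' = 1 then |β| / (2 * (2 * M) : ℕ) * ∑ z : TorusSite 2 L, ‖framePosKernel L K z‖ * (1 + torusSiteDist z 0) else if m' = 2 then |U| * |β| / (2 * (2 * M) : ℕ) else 0))) /
          (1 - Real.exp 1 * (4 * M * Abar / β) *
        normV (GridLeg (GridPoint L (2 * (2 * M)))) κ₀ κ₀
          ((fun m' : ℕ => if m' = 1 then |β| / (2 * (2 * M) : ℕ) * ∑ z : TorusSite 2 L, ‖framePosKernel L K z‖ * (1 + torusSiteDist z 0) else if m' = 2 then |U| * |β| / (2 * (2 * M) : ℕ) else 0)) / κ₀ ^ 2)))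
        ≤ imagTimeWeight β M * (M / β * t * (2 * (M / β * t)) * (κ₀⁻¹ ^ 2 * (Real.exp 1 * ((Real.exp 2 * (κ₀ + κ₀)) ^ 2 * (|β| / (2 * (2 * M) : ℕ) * kKbar) + (Real.exp 2 * (κ₀ + κ₀)) ^ 4 * (|U| * |β| / (2 * (2 * M) : ℕ)))) / (1 / 2))) := by
          refine mul_le_mul_of_nonneg_left (mul_le_mul_of_nonneg_left ?_ (by positivity)) hε0
          exact div_le_div₀ hnum0 (mul_le_mul_of_nonneg_left (mul_le_mul_of_nonneg_left hnVle (Real.exp_pos 1).le) (by positivity))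
            (by norm_num) hθv1
      _ = 2 * t ^ 2 * (Real.exp 1 ^ 5 * kKbar + 4 * Real.exp 1 ^ 9 * κ₀ ^ 2 * |U|) := by
          rw [hε, hN4, abs_of_pos hβ0, he2]
          field_simp
          ring
  · -- degrees `2p ≥ 4`
    intro p hp
    refine le_trans ?_ (hNp p hp)
    obtain ⟨p', rfl⟩ : ∃ p', p = p' + 2 := ⟨p - 2, by omega⟩
    rw [hsc, show 2 * (p' + 2) - 1 = 2 * p' + 3 by omega, show p' + 2 - 2 = p' from rfl, show 2 * (p' + 2) = 2 * p' + 4 by omega]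
    set Q := imagTimeWeight β M ^ (2 * p' + 3) * (M / β * t * (2 * (M / β * t)) ^ (2 * p' + 3) *
        (κ₀⁻¹ ^ (2 * p' + 4) * (Real.exp 1 * ((Real.exp 2 * (κ₀ + κ₀)) ^ (2 * 2) * (|U| * |β| / (2 * (2 * M) : ℕ)))) *
          (Real.exp 1 * (4 * M * Abar / β) * ((Real.exp 2 * (κ₀ + κ₀)) ^ (2 * 2) * (|U| * |β| / (2 * (2 * M) : ℕ))) / κ₀ ^ 2) ^ p')) with hQ
    have hQ0 : 0 ≤ Q := by positivity
    have hden : (1 / 2 : ℝ) ^ (p' + 2) ≤ (1 - Real.exp 1 * (4 * M * Abar / β) *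
        normV (GridLeg (GridPoint L (2 * (2 * M)))) κ₀ κ₀
          ((fun m' : ℕ => if m' = 1 then |β| / (2 * (2 * M) : ℕ) * ∑ z : TorusSite 2 L, ‖framePosKernel L K z‖ * (1 + torusSiteDist z 0) else if m' = 2 then |U| * |β| / (2 * (2 * M) : ℕ) else 0)) / κ₀ ^ 2) ^ (p' + 2) :=
      pow_le_pow_left₀ (by norm_num) hθv1 _
    have hreassoc : imagTimeWeight β M ^ (2 * p' + 3) * (M / β * t * (2 * (M / β * t)) ^ (2 * p' + 3) *
        (κ₀⁻¹ ^ (2 * p' + 4) * (Real.exp 1 * ((Real.exp 2 * (κ₀ + κ₀)) ^ (2 * 2) * (|U| * |β| / (2 * (2 * M) : ℕ)))) *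
          (Real.exp 1 * (4 * M * Abar / β) * ((Real.exp 2 * (κ₀ + κ₀)) ^ (2 * 2) * (|U| * |β| / (2 * (2 * M) : ℕ))) / κ₀ ^ 2) ^ p' /
            (1 - Real.exp 1 * (4 * M * Abar / β) *
        normV (GridLeg (GridPoint L (2 * (2 * M)))) κ₀ κ₀
          ((fun m' : ℕ => if m' = 1 then |β| / (2 * (2 * M) : ℕ) * ∑ z : TorusSite 2 L, ‖framePosKernel L K z‖ * (1 + torusSiteDist z 0) else if m' = 2 then |U| * |β| / (2 * (2 * M) : ℕ) else 0)) / κ₀ ^ 2) ^ (p' + 2))) =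
        Q / (1 - Real.exp 1 * (4 * M * Abar / β) *
        normV (GridLeg (GridPoint L (2 * (2 * M)))) κ₀ κ₀
          ((fun m' : ℕ => if m' = 1 then |β| / (2 * (2 * M) : ℕ) * ∑ z : TorusSite 2 L, ‖framePosKernel L K z‖ * (1 + torusSiteDist z 0) else if m' = 2 then |U| * |β| / (2 * (2 * M) : ℕ) else 0)) / κ₀ ^ 2) ^ (p' + 2) := by
      rw [hQ]; ring
    rw [hreassoc]
    calc Q / (1 - Real.exp 1 * (4 * M * Abar / β) *
        normV (GridLeg (GridPoint L (2 * (2 * M)))) κ₀ κ₀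
          ((fun m' : ℕ => if m' = 1 then |β| / (2 * (2 * M) : ℕ) * ∑ z : TorusSite 2 L, ‖framePosKernel L K z‖ * (1 + torusSiteDist z 0) else if m' = 2 then |U| * |β| / (2 * (2 * M) : ℕ) else 0)) / κ₀ ^ 2) ^ (p' + 2)
        ≤ Q / (1 / 2 : ℝ) ^ (p' + 2) := div_le_div_of_nonneg_left hQ0 (by positivity) hden
      _ = 2 ^ (p' + 2) * Q := by rw [one_div, inv_pow, div_inv_eq_mul, mul_comm]
      _ = 2 ^ (p' + 2) * (4 * Real.exp 1 ^ 9 * κ₀ ^ 4 * κ₀⁻¹ ^ (2 * p' + 4) * t ^ (2 * p' + 4) *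
            (16 * Real.exp 1 ^ 9 * κ₀ ^ 2 * Abar * |U|) ^ p' * |U|) := by
          have ha : imagTimeWeight β M * (2 * (M / β * t)) = t := by rw [hε]; field_simp
          have hb : Real.exp 1 * (4 * M * Abar / β) * ((Real.exp 2 * (κ₀ + κ₀)) ^ (2 * 2) * (|U| * |β| / (2 * (2 * M) : ℕ))) / κ₀ ^ 2 =
              16 * Real.exp 1 ^ 9 * κ₀ ^ 2 * Abar * |U| := by
            rw [hN4, abs_of_pos hβ0, he2]; field_simp; ring
          have hc : M / β * t * (Real.exp 1 * ((Real.exp 2 * (κ₀ + κ₀)) ^ (2 * 2) * (|U| * |β| / (2 * (2 * M) : ℕ)))) = 4 * Real.exp 1 ^ 9 * κ₀ ^ 4 * |U| * t := by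
            rw [hN4, abs_of_pos hβ0, he2]; field_simp; ring
          have hQ' : Q = t ^ (2 * p' + 3) * (4 * Real.exp 1 ^ 9 * κ₀ ^ 4 * |U| * t) * κ₀⁻¹ ^ (2 * p' + 4) *
              (16 * Real.exp 1 ^ 9 * κ₀ ^ 2 * Abar * |U|) ^ p' := by
            calc Q = (imagTimeWeight β M * (2 * (M / β * t))) ^ (2 * p' + 3) * (M / β * t * (Real.exp 1 * ((Real.exp 2 * (κ₀ + κ₀)) ^ (2 * 2) * (|U| * |β| / (2 * (2 * M) : ℕ))))) *
                  κ₀⁻¹ ^ (2 * p' + 4) * (Real.exp 1 * (4 * M * Abar / β) * ((Real.exp 2 * (κ₀ + κ₀)) ^ (2 * 2) * (|U| * |β| / (2 * (2 * M) : ℕ))) / κ₀ ^ 2) ^ p' := by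
                    rw [hQ, mul_pow]; ring
              _ = _ := by rw [ha, hc, hb]
          rw [hQ']
          ring

end Summit.HubbardSuperconductivity.HubbardSuperconductivity.Theorems.EngineV8

end
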